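import Summits.QuantumFields.YangMills.Theorems.BalabanUVNodesN12DirectSurjHsurjUniformB
import Summits.QuantumFields.YangMills.Theorems.BalabanUVNodesN12DirectSurjHullCount

/-!
# BalabanUVNodes ∕ N12 — (P4)′: the per-row ℓ¹ preimage letter `hrow` with `B₁ = h(d,L,k)·B` PER HEIGHT (`∃ ε > 0, ∃ B₁ ≥ 0, ∀ (M₁, Z) …`) — the hull count of `…HullCount` over the
# uniform-`B` support edition `…HsurjUniformB`

Cell `pub-ymgap` (HUMAN RULINGS D-0062 ∕ D-0149), WIDTH SEAT `pub-ymgap-dag-n12-w6` g9 (node N12 = [B15]; key K1⁹ `stmt-QuantumFields-27364`, `--kind proof --supports … --as helper`;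
count-neutral).  THEOREMS ONLY (0 `def`, 0 `instance`, 0 `sorry`).

WHY.  `…HullCount.exists_rightInverse_hrow_explicit` inhabits the lane's ρ6b letter `hrow` at `B₁ = h(d,L,k)·B` with `h` explicit, but through p685789 ∕ p685568 whose `B` is chosen AFTER
`(M₁, Z)`.  Over the uniform-`B` edition (`exists_rightInverse_letter_support_uniformB`: `∃ ε, ∃ B, ∀ M₁ Z …`) the same two steps — row-wise superposition `H′ v := Σ_i H(e_i v_i)`
(a right inverse since `DΨ(0)` is linear; each summand one-row data, supported on the row's hull by `hHsupp″`, of sup norm `≤ B‖v_i‖`) and the hull count `exists_rowHull_Bj` — give the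
letter with `B₁ := h(d,L,k)·B` chosen PER HEIGHT `(F, K, k, N)`, before the instance.

CONTENTS.  ★★★ `exists_rightInverse_hrow_uniformB` — `∃ ε > 0, ∃ B₁ ≥ 0, ∀ M₁ ≥ 1, Z, (2.13)-divisibility, W, U₀:` p678596's hypotheses ⟹ `∃ H, (DΨ(0) ∘ H = id) ∧ (‖H v‖ ≤ B₁·Σ_i‖v_i‖) ∧
(Σ_b ‖H v b‖ ≤ B₁·Σ_i ‖v_i‖) ∧ ∀ i, 1 ≤ level i → ∀ ξ, ∃ x, DΨ(0) x = e_i ξ ∧ Σ_b ‖↑x_b‖_op ≤ B₁‖ξ‖`.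

HONEST FRAMING.  Bookkeeping by name; `B₁ = h(d,L,k)·β(k+1)(1+Λβ)^{k+1}` per height, its VALUE still torus-dependent through `C_p = #PBond` and the compactness constants (census U4) —
print's volume-free (46) NOT claimed; nothing of Bałaban's asserted or refuted; N12 NOT discharged; K1⁹ NOT closed; count-neutral; R4 closes only the conditional finite-`𝕋⁴` rung
`BalabanLadder.UV`; no summit statement is proved here and NOT the Yang–Mills mass gap (Clay).
-/

noncomputable section

open scoped BigOperators Matrix.Norms.L2Operator Topology NNReal
open Filter

namespace Summit.QuantumFields.YangMills.BalabanUVNodes.N12DirectSurjHullCountUniformB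

open Literature.MathematicalPhysics.QuantumFieldTheory.Balaban1983to89
open Node00 B15DeterminingSets
open T4Continuum (T4Family)
open T4AdjointCovarianceUnitary (lieSU)
open B14.Eq213DetSet (Bj maxDomT)
open B14.Eq213MaximalDomains (side)
open B14.Eq216Concrete (feeds)
open B5Eq118OneStroke (iterBlockOf)
open B15Eq112TorusCover (lift)
open T4AxialGaugeSmallField (boxPlaqs)
open B16Ineq19NearFlatSliceNorms (opNorm_coe_le_norm_lieSU)
open Summit.QuantumFields.YangMills.BalabanUVNodes.N12DirectSurjHsurjL1 (sum_norm_le_card_mul_norm_of_subset)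
open Summit.QuantumFields.YangMills.BalabanUVNodes.N12DirectSurjHsurjUniformB (exists_rightInverse_letter_support_uniformB)
open Summit.QuantumFields.YangMills.BalabanUVNodes.N12DirectSurjHullCount (exists_rowHull_Bj)

section Record

variable {F : T4Family} {N : ℕ} [NeZero N] {K k : ℕ}

/-- ★★★ **THE PER-ROW ℓ¹ PREIMAGE LETTER WITH `B₁ = h(d,L,k)·B` PER HEIGHT.**  ONE `ε > 0` and ONE `B₁ ≥ 0` per `(F, K, k, N)` (`B₁ = 2d(k+1)(2d+1)^k L^{kd} · B`, `B` the per-height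
sup-norm letter of `exists_rightInverse_letter_support_uniformB`) such that, for every `M₁ ≥ 1`, `Z` with (2.13)'s divisibility, `W`, `U₀` in the fibre with the guarded proxies and
the box plaquette letter: a right inverse `H` of `DΨ_{𝐁_k(Z),W,U₀}(0)` (the row-wise superposition of the support edition's) with `‖H v‖ ≤ B₁·Σ_i ‖v_i‖`, the ℓ¹ → ℓ¹ letter
`Σ_b ‖H v b‖ ≤ B₁·Σ_i ‖v_i‖`, and the lane's per-row letter `∀ i, 1 ≤ level i → ∀ ξ, ∃ x, DΨ(0) x = e_i ξ ∧ Σ_b ‖↑x_b‖_op ≤ B₁‖ξ‖`.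
[cite: Balaban1985Variational, (45)–(46) p.285, (83) p.290; Balaban1988Convergent, (2.2) p.255, (2.10)-(2.13) pp.256-257; Balaban1987RG1, (0.4) p.253] -/
theorem exists_rightInverse_hrow_uniformB (hkK : k + 1 ≤ (F.P K).m + (F.P K).K) :
    ∃ ε : ℝ, 0 < ε ∧ ∃ B₁ : ℝ, 0 ≤ B₁ ∧ ∀ (M₁ : ℕ) (_ : 1 ≤ M₁) (Z : Set (Site (F.P K) 0)) (_ : side (F.P K).L M₁ k ∣ (F.P K).sitesPerDir 0)
      (W : MSField (F.P K) (SU N)) (U₀ : GaugeField (F.P K) 0 (SU N)),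
        AgreeOn (Bj M₁ Z k) (avgFamily (avOfRecord F N K) U₀) W →
        (∀ i : Fin (constrCard (Bj M₁ Z k) k), ∃ U' : GaugeField (F.P K) 0 (SU N),
          (∀ b ∈ feeds (((constrEnum (Bj M₁ Z k) k).symm i).1 : ℕ) ((constrEnum (Bj M₁ Z k) k).symm i).2.1, U' b = U₀ b) ∧ SmallBelow (avOfRecord F N K) k U') →
        (∀ (j : ℕ), 1 ≤ j → j ≤ k → ∀ y : Site (F.P K) j, embIter j y ∈ maxDomT M₁ Z j → ∃ U' : GaugeField (F.P K) 0 (SU N),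
          (∀ c : PBond (F.P K) j, (c.src = y ∨ c.tgt = y) → ∀ b₀ : PBond (F.P K) 0,
            (iterBlockOf j b₀.src = c.src ∨ iterBlockOf j b₀.src = c.tgt) → (iterBlockOf j b₀.tgt = c.src ∨ iterBlockOf j b₀.tgt = c.tgt) → U' b₀ = U₀ b₀) ∧
          SmallBelow (avOfRecord F N K) k U') →
        (∀ (j : ℕ), 1 ≤ j → j ≤ k → ∀ y : Site (F.P K) j, embIter j y ∈ maxDomT M₁ Z j →
          PlaqSmallOn (boxPlaqs (P := F.P K) (j := 0)
            (fun κ => lift (F.P K) (embIter j y) κ - ((((F.P K).L ^ j : ℕ) : ℤ) + ((((F.P K).L ^ j - 1) / 2 : ℕ) : ℤ)))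
            (fun κ => lift (F.P K) (embIter j y) κ + ((((F.P K).L ^ j : ℕ) : ℤ) + ((((F.P K).L ^ j - 1) / 2 : ℕ) : ℤ)))) ε U₀) →
        ∃ H : (Fin (constrCard (Bj M₁ Z k) k) → lieSU (Fin N)) → PBond (F.P K) 0 → lieSU (Fin N),
          (∀ v, fderiv ℝ (msChart F N K k (Bj M₁ Z k) W U₀) 0 (H v) = v) ∧
          (∀ v, ‖H v‖ ≤ B₁ * ∑ i, ‖v i‖) ∧
          (∀ v, ∑ b, ‖H v b‖ ≤ B₁ * ∑ i, ‖v i‖) ∧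
          ∀ i : Fin (constrCard (Bj M₁ Z k) k), 1 ≤ ((((constrEnum (Bj M₁ Z k) k).symm i).1 : ℕ)) → ∀ ξ : lieSU (Fin N),
            ∃ x : PBond (F.P K) 0 → lieSU (Fin N), fderiv ℝ (msChart F N K k (Bj M₁ Z k) W U₀) 0 x = Pi.single i ξ ∧
              ∑ b, ‖(x b : Matrix (Fin N) (Fin N) ℂ)‖ ≤ B₁ * ‖ξ‖ := by
  classical
  have hk : k ≤ (F.P K).m + (F.P K).K := Nat.le_of_succ_le hkK
  obtain ⟨ε, hε, B, hB0, hB⟩ := exists_rightInverse_letter_support_uniformB (F := F) (N := N) (K := K) (k := k) hkK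
  set h : ℕ := 2 * (F.P K).d * (k + 1) * (2 * (F.P K).d + 1) ^ k * ((F.P K).L ^ (F.P K).d) ^ k with hh_def
  have h1 : (1 : ℝ) ≤ h := by
    have hd : 1 ≤ (F.P K).d := (F.P K).hd
    have hL : 1 ≤ ((F.P K).L ^ (F.P K).d) ^ k := Nat.one_le_pow _ _ (pow_pos (F.P K).L_pos _)
    have h2 : 1 ≤ (2 * (F.P K).d + 1) ^ k := Nat.one_le_pow _ _ (Nat.succ_pos _)
    have : 1 ≤ h := by
      rw [hh_def]
      calc 1 ≤ 2 * (F.P K).d * (k + 1) := by nlinarith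
        _ ≤ 2 * (F.P K).d * (k + 1) * (2 * (F.P K).d + 1) ^ k := Nat.le_mul_of_pos_right _ (by positivity)
        _ ≤ 2 * (F.P K).d * (k + 1) * (2 * (F.P K).d + 1) ^ k * ((F.P K).L ^ (F.P K).d) ^ k := Nat.le_mul_of_pos_right _ (by positivity)
    exact_mod_cast this
  refine ⟨ε, hε, h * B, mul_nonneg (Nat.cast_nonneg _) hB0, fun M₁ hM1 Z hdiv W U₀ hU hprox hproxSite hplaq => ?_⟩
  obtain ⟨H, hHinv, hHsup, -, hHsupp⟩ := hB M₁ hM1 Z hdiv W U₀ hU hprox hproxSite hplaq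
  -- the one-row charges and their sup norms
  have hns : ∀ (v : Fin (constrCard (Bj M₁ Z k) k) → lieSU (Fin N)) (i : Fin (constrCard (Bj M₁ Z k) k)),
      ‖Pi.single (M := fun _ => lieSU (Fin N)) i (v i)‖ ≤ ‖v i‖ := fun v i =>
    (pi_norm_le_iff_of_nonneg (norm_nonneg _)).2 fun i' => by
      by_cases hi : i' = i
      · subst hi; rw [Pi.single_eq_same]
      · rw [Pi.single_eq_of_ne hi, norm_zero]; exact norm_nonneg _
  -- each one-row summand: supported on the row's hull (≤ h bonds), sup norm ≤ B‖v_i‖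
  have hrow : ∀ (v : Fin (constrCard (Bj M₁ Z k) k) → lieSU (Fin N)) (i : Fin (constrCard (Bj M₁ Z k) k)),
      ∑ b, ‖H (Pi.single i (v i)) b‖ ≤ h * (B * ‖v i‖) := by
    intro v i
    obtain ⟨𝒮, T, hT, hTh, ha, hb⟩ := exists_rowHull_Bj (P := F.P K) hk M₁ Z i
    have hne : ∀ i', Pi.single (M := fun _ => lieSU (Fin N)) i (v i) i' ≠ 0 → i' = i := fun i' hi' => by
      by_contra hii
      exact hi' (Pi.single_eq_of_ne hii _)
    have hzero : ∀ b, b ∉ T → H (Pi.single i (v i)) b = 0 := fun b hbT =>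
      hHsupp (Pi.single i (v i)) 𝒮 (fun b' hb' hv => ha b' hb' (hne _ hv))
        (fun j hj hjk c hc hc' y hy hin b₀ hs ht hf => hb j hj hjk c hc (hc'.imp (fun hv => hne _ hv) id) y hy hin b₀ hs ht hf)
        b fun m hm => hbT (hT m b hm)
    calc ∑ b, ‖H (Pi.single i (v i)) b‖ ≤ (T.card : ℝ) * ‖H (Pi.single i (v i))‖ := sum_norm_le_card_mul_norm_of_subset _ T hzero
      _ ≤ h * (B * ‖v i‖) :=
          mul_le_mul (by exact_mod_cast hTh) ((hHsup _).trans (mul_le_mul_of_nonneg_left (hns v i) hB0)) (norm_nonneg _) (Nat.cast_nonneg _)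
  have hsum1 : ∀ (i : Fin (constrCard (Bj M₁ Z k) k)) (ξ : lieSU (Fin N)), ∑ i', ‖Pi.single (M := fun _ => lieSU (Fin N)) i ξ i'‖ = ‖ξ‖ := fun i ξ => by
    rw [Finset.sum_eq_single i (fun i' _ hi' => by rw [Pi.single_eq_of_ne hi', norm_zero]) (fun h => absurd (Finset.mem_univ i) h), Pi.single_eq_same]
  -- the row-wise superposition
  have hl1 : ∀ v : Fin (constrCard (Bj M₁ Z k) k) → lieSU (Fin N), ∑ b, ‖(∑ i, H (Pi.single i (v i))) b‖ ≤ h * B * ∑ i, ‖v i‖ := fun v =>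
    calc ∑ b, ‖(∑ i, H (Pi.single i (v i))) b‖ = ∑ b, ‖∑ i, H (Pi.single i (v i)) b‖ := by simp_rw [Finset.sum_apply]
      _ ≤ ∑ b, ∑ i, ‖H (Pi.single i (v i)) b‖ := Finset.sum_le_sum fun b _ => norm_sum_le _ _
      _ = ∑ i, ∑ b, ‖H (Pi.single i (v i)) b‖ := Finset.sum_comm
      _ ≤ ∑ i, h * (B * ‖v i‖) := Finset.sum_le_sum fun i _ => hrow v i
      _ = h * B * ∑ i, ‖v i‖ := by rw [Finset.mul_sum]; simp_rw [mul_assoc]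
  refine ⟨fun v => ∑ i, H (Pi.single i (v i)), fun v => ?_, fun v => ?_, hl1, fun i _ ξ => ?_⟩
  · -- right inverse: `L` is linear
    rw [map_sum]
    simp_rw [hHinv]
    exact Finset.univ_sum_single v
  · -- sup letter (`B ≤ h·B`)
    calc ‖∑ i, H (Pi.single i (v i))‖ ≤ ∑ i, ‖H (Pi.single i (v i))‖ := norm_sum_le _ _
      _ ≤ ∑ i, B * ‖v i‖ := Finset.sum_le_sum fun i _ => (hHsup _).trans (mul_le_mul_of_nonneg_left (hns v i) hB0)
      _ = B * ∑ i, ‖v i‖ := by rw [Finset.mul_sum]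
      _ ≤ h * B * ∑ i, ‖v i‖ := by
          rw [mul_assoc]
          exact le_mul_of_one_le_left (mul_nonneg hB0 (Finset.sum_nonneg fun i _ => norm_nonneg _)) h1
  · -- the per-row letter: `x := H′ (e_i ξ)`, operator norm ≤ Hilbert–Schmidt norm, `Σ_{i'} ‖(e_i ξ) i'‖ = ‖ξ‖`
    refine ⟨∑ i', H (Pi.single i' (Pi.single (M := fun _ => lieSU (Fin N)) i ξ i')), ?_, ?_⟩
    · rw [map_sum]
      simp_rw [hHinv]
      exact Finset.univ_sum_single _
    · calc ∑ b, ‖((((∑ i', H (Pi.single i' (Pi.single (M := fun _ => lieSU (Fin N)) i ξ i'))) b : lieSU (Fin N)) : Matrix (Fin N) (Fin N) ℂ))‖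
          ≤ ∑ b, ‖(∑ i', H (Pi.single i' (Pi.single (M := fun _ => lieSU (Fin N)) i ξ i'))) b‖ := Finset.sum_le_sum fun b _ => opNorm_coe_le_norm_lieSU _
        _ ≤ h * B * ∑ i', ‖Pi.single (M := fun _ => lieSU (Fin N)) i ξ i'‖ := hl1 _
        _ = h * B * ‖ξ‖ := by rw [hsum1]

end Record

end Summit.QuantumFields.YangMills.BalabanUVNodes.N12DirectSurjHullCountUniformB

end
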